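import Summits.ValiantsHypothesis.ValiantsHypothesis.Theorems.LacunarySymmetroidMatrixDescartesCensusV19CCheck
import Summits.ValiantsHypothesis.ValiantsHypothesis.Theorems.LacunarySymmetroidMatrixDescartesCensusV19CBox18Keys
import Summits.ValiantsHypothesis.ValiantsHypothesis.Theorems.LacunarySymmetroidMatrixDescartesCensusV20CoverX

/-!
# `MatrixDescartes` census — CASE C (`V = 19`), box `d₅ ≤ 18`: the kernel COVER check (every sorted one-collision support is a key, the mirror of a key, or a named exception)

HONEST FRAMING.  Object-search cell `pub-symmetroid`; door-A item `DoorA26 = PosRootLawAt 2 6 19` (stmt-ValiantsHypothesis-19979; OPEN, typed, never asserted)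
and its sharper support rows `PosRootLawOn 2 6 18 d`.  DATA ONLY: Boolean facts by `decide +kernel` — the slice plan exhausts the tops `d₅ ≤ 18`
(`V20.planCoversR`), and `V19C.coverSlicesX` enumerates every sorted support `0 = d₀ < ⋯ < d₅ ≤ 18` and checks that each one with exactly `20` distinct pair
sums (`V19C.oneColl`) is one of the `469` keys `V19C.box18Keys`, the mirror of one, or one of the `24` named exceptions `V19C.caseC18Open`.  The meaning is
attached in the box assembly `…CensusV19CBox18` by the cover soundness theorem of `…CensusV19CSoundCover`.  Nothing here bears on the `2`-Sidon supports,
on `ζ_sym(2,6)` over all supports, on `MatrixDescartes` (stmt-ValiantsHypothesis-18050) or on `VP ≠ VNP`.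

[folklore] Bookkeeping; elementary.
-/

-- the D-0017 layout repeats a namespace component (single-conjunct summit); the `dupNamespace` linter flags it; name mandated.
set_option linter.dupNamespace false

namespace Summit.ValiantsHypothesis.ValiantsHypothesis.Theorems.LacunarySymmetroidMatrixDescartes.Census.V19C

/-- The slice plan of the box `d₅ ≤ 18`: one slice `(f, 4, f − 1)` per top `f = 5, …, 18`. [folklore] -/
def plan18 : List (ℕ × ℕ × ℕ) :=
  [(5, 4, 4), (6, 4, 5), (7, 4, 6), (8, 4, 7), (9, 4, 8), (10, 4, 9), (11, 4, 10), (12, 4, 11), (13, 4, 12), (14, 4, 13), (15, 4, 14),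
    (16, 4, 15), (17, 4, 16), (18, 4, 17)]

/-- The slice plan exhausts the tops `0 ≤ f ≤ 18`. [folklore] -/
theorem plan18_covers : V20.planCoversR 0 18 plan18 = true := by
  decide +kernel

/-- **Cover check (kernel)**: every sorted one-collision support with `d₅ ≤ 18` is a key of `box18Keys`, the mirror of a key, or in `caseC18Open`. [folklore] -/
theorem cover18 : coverSlicesX caseC18Open box18Keys plan18 = true := by
  decide +kernel

end Summit.ValiantsHypothesis.ValiantsHypothesis.Theorems.LacunarySymmetroidMatrixDescartes.Census.V19C
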